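import Summits.ResolutionOfSingularities.ResolutionOfSingularities.Theorems.EquisingularLiftEquisingularLiftNatEmbeddedLiftOfInfinitesimalPrincipal
import Summits.ResolutionOfSingularities.ResolutionOfSingularities.Theorems.EquisingularLiftEquisingularLiftNatNodalCurveLiftOfGEPrincipal
import Summits.ResolutionOfSingularities.ResolutionOfSingularities.Theorems.EquisingularLiftEquisingularLiftNatEmbeddedInfinitesimalLift
import Summits.ResolutionOfSingularities.ResolutionOfSingularities.Theorems.EquisingularLiftEquisingularLiftNatGEPrincipalThickenings
import HarnessLib

/-!
# [OURS · L1 W4.5(b) · EL♮(3)] THE DOOR'S FOUR LIFT FACTS HOLD UNCONDITIONALLY, BY NAME: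
# `embeddedLiftFact_holds`, `embeddedCurveLiftFact_holds`, `nodalCurveLiftFact_holds`, `nodalHostedRoundFact_holds`

Crux chain w45b (cell `res-hironaka`, slot W4.5(b)), working crux **EL♮** = stmt-ResolutionOfSingularities-20038, child **EL♮(3)** =
stmt-ResolutionOfSingularities-20148, route EquisingularLift, line `sections`.  Written by res-type-027 g23 after E♭ (✓ p701591
`GEPrincipal.grothendieckExistence_principal`), TWIN-1♭ (✓ p701206, res-L1-w45b-lead-2 g9), TWIN-2 (✓ p701099, res-L1-w45b-stub-4 g14 over ✓ p700301,
res-L1-w45b-nose-w1 g5) and J1 (✓ `embeddedInfinitesimalLiftFact_holds`, res-type-027 g17): the four OURS lift statements of the door at n = 3 —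
`EmbeddedLiftFact` (…NatEmbeddedLiftFactDefs), `EmbeddedCurveLiftFact` (…NatTowerRoundFourDefs), `NodalCurveLiftFact` (…NatNodalCurveLiftDefs),
`NodalHostedRoundFact` (…NatNodalHostedRoundDefs) — are now THEOREMS WITH NO HYPOTHESIS; this file records them under the canonical `_holds` names so
that rungs and future texts may cite one token instead of re-assembling the cone (the 45th «F-88 RETIREMENT» texts of record derive the same terms
inline; nothing registered changes).  HONEST FRAMING: OURS statements about OUR tower (Hartshorne 2010 Thm. 22.3-type embedded lifting in a proper
flat ambient over a complete DVR, and its nodal hosted-round variant); NOT statements of H. Hironaka's 2017 manuscript, nothing of it is asserted or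
used; AI-written, gate-checked, weaker than expert review; EL♮(3) NOT proved; resolution in positive characteristic NOT proved.  No `sorry`; standard
axioms; DEF-FREE.  `--supports stmt-ResolutionOfSingularities-20148 --as helper`.

PROOF = one line each: the principal-GE twins applied to J1 and E♭ (`GEPrincipal.grothendieckExistence_principal.{0}` has the twins' `hGEp` type verbatim).
References (method / index only): R. Hartshorne, *Deformation Theory* (2010), Thm. 6.2 (b), 9.2 (b), 22.3; EGA III₁ 5.1.4 / 5.1.8; Görtz–Wedhorn II 24.94, 24.109.
-/

set_option linter.dupNamespace false -- mandated namespace `Summit.<Summit>.<Problem>` of this single-conjunct summit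

noncomputable section

namespace Summit.ResolutionOfSingularities.ResolutionOfSingularities.Cruxes.EquisingularLiftNat.Sections

/-- **`EmbeddedLiftFact` HOLDS** (Hartshorne 2010 Thm. 22.3 with a general proper flat ambient over a complete DVR, in the chain's currency):
J1 ✓ + E♭ ✓ through TWIN-1♭. [OURS · L1 W4.5b · counted 0] -/
theorem embeddedLiftFact_holds : EmbeddedLiftFact :=
  embeddedLiftFact_of_infinitesimal_of_grothendieckExistencePrincipal embeddedInfinitesimalLiftFact_holds
    GEPrincipal.grothendieckExistence_principal

/-- **`EmbeddedCurveLiftFact` HOLDS** (the (T-k) hypothesis of the tower rungs). [OURS · L1 W4.5b · counted 0] -/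
theorem embeddedCurveLiftFact_holds : EmbeddedCurveLiftFact :=
  embeddedCurveLiftFact_of_infinitesimal_of_grothendieckExistencePrincipal embeddedInfinitesimalLiftFact_holds
    GEPrincipal.grothendieckExistence_principal

/-- **`NodalCurveLiftFact` HOLDS** (S-D8-LIFT part 4 (C), stub-4's assembly, through E♭). [OURS · L1 W4.5b · counted 0] -/
theorem nodalCurveLiftFact_holds : NodalCurveLiftFact :=
  nodalCurveLiftFact_of_grothendieckExistencePrincipal GEPrincipal.grothendieckExistence_principal

/-- **`NodalHostedRoundFact` HOLDS** (the (HR-KEEP-N) lift licence of the rung⁸ `nd_leaves_rung_threeP8`; the 43rd's ADD-FACT, dropped by the 44th,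
now a hypothesis-free theorem by name). [OURS · L1 W4.5b · counted 0] -/
theorem nodalHostedRoundFact_holds : NodalHostedRoundFact :=
  nodalHostedRoundFact_of_grothendieckExistencePrincipal GEPrincipal.grothendieckExistence_principal

end Summit.ResolutionOfSingularities.ResolutionOfSingularities.Cruxes.EquisingularLiftNat.Sections

end
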